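import Literature.MathematicalPhysics.QuantumFieldTheory.IsingGaugeWilsonLoopCovarianceLowerBound
import Literature.MathematicalPhysics.QuantumFieldTheory.IsingGaugePlaquetteCovarianceConfined
import Literature.Probability.LatticeModels.IsingProductCovarianceBound
import Literature.Probability.LatticeModels.IsingOddOddTwoPointBound
import HarnessLib

/-!
# Exponential clustering of Wilson loops of `ℤ₂` lattice gauge theory on `ℤ³` in the CONFINED phase,
# modulo Duminil-Copin–Goswami–Raoufi 2020 Thm 1.1 — and hence at every `β ≠ β_c`
(Forsström–Viklund 2025, Prop. 6.8 ∕ Duncan–Schweinhart 2026, Prop. 24 (fixed loops), `d = 3`, `q = 2`,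
GENERAL rectangular loops)

Topic `MathematicalPhysics/QuantumFieldTheory`. Theorem-only file (no definitions, no named facts).

For two rectangular Wilson loops `γ = ∂𝒮`, `γ' = ∂𝒮'` of `ℤ₂` lattice gauge theory on `ℤ³` (free
infinite-volume state), flat sheets `𝒮 = rectPlaqs x i j R T`, `𝒮' = rectPlaqs x' i' j' R' T'`
(`i < j`, `i' < j'`), the tree has the DECONFINED phase `β > β_c = z2GaugeCriticalBetaThree`
(`Z2Duality.znWilsonPairCov_deconfined_clustering`: duality + Glimm–Jaffe §17.2 + Ising sharpness) and
strong coupling (`znWilsonPairCov_strongCoupling_clustering`, Osterwalder–Seiler). This file adds the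
whole CONFINED phase `0 < β < β_c`, modulo the tree's named fact
`DuminilCopinGoswamiRaoufi2020_truncatedTwoPointPlus_expDecay 3` (exponential decay of the truncated
two-point function of the plus state of the Ising model on `ℤ³` throughout `β* > β_c^{Ising}`):

* §1 geometry of flat sheets (distances of dual vertices; as in the deconfined file);
* §2 from a truncated-two-point bound `⟨σ_a;σ_b⟩⁺_{β*} ≤ e^{-κ‖a-b‖}` to the bound
  `0 ≤ Cov⁺_{β*}(σ_A,σ_B) ≤ (|A|+|B|)!·|A||B|·e^{-κD}` for disjoint `A, B` at distance `≥ D` — the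
  tree's Duminil-Copin–Goswami–Raoufi Lemma 1.2 for general sets
  (`plusCorr_cov_disjoint_le_factorial_mul_sum_truncated`, proved in
  `Literature/Probability/LatticeModels/IsingProductCovarianceBound.lean` by Ginibre's duplicated
  system) — `plusCov_decay_of_truncated_decay`;
* §3 the far-loops bound through the duality of truncated correlations
  `znWilsonPairCov_eq_sum_plusCov` (all `β > 0`) and §4 the clustering theorem for every `β > 0`
  at whose dual temperature the truncated two-point function decays
  (`znWilsonPairCov_clustering_of_truncated_decay`);
* §5 the confined phase: `0 < β < β_c ⟹ β* > β_c^{Ising}` (`criticalBeta_lt_dualBeta`), so DCGR20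
  Thm 1.1 applies — `znWilsonPairCov_confined_clustering_of_DCGR2020`; with the deconfined theorem,
  clustering at EVERY `β ≠ β_c` modulo the fact (`znWilsonPairCov_clustering_of_ne_critical_of_DCGR2020`),
  which is Forsström–Viklund's Prop. 6.8 for `d = 3` and the fixed-loop case of Duncan–Schweinhart's
  Prop. 24 at every non-critical `β`, with the critical point identified; §6 two-sided bounds for
  translates `γ' = γ + N e_k` with the tree's lower bound `znWilsonPairCov_two_translate_ge_exp`;
* §7 SHARP constants: with Lemma 1.2 at constant `1` (`plusCorr_cov_disjoint_le_sum_truncated`,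
  `Literature/Probability/LatticeModels/IsingOddOddTwoPointBound.lean`, random-current pair switching)
  the combinatorial factor `(2|𝒮|+2|𝒮'|)!` of §3 disappears: `Cov⁺ ≤ |A||B| e^{-κD}` and a far-loops
  bound growing only like `e^{O(|𝒮|+|𝒮'|)}` (`znWilsonPairCov_le_of_truncated_decay_of_far_sharp`);
  §8 the dual input in the deconfined phase as a truncated-two-point bound (sharpness at
  `β* < β_c^{Ising}`, plus = free, `⟨σ_a⟩^∅ = 0`): `plusCorr_truncatedTwoPoint_dualBeta_expDecay_of_gt_critical`;
  §9 GROWING loops — Duncan–Schweinhart 2026 Prop. 24, upper bound, `q = 2`, `d = 3`: for squares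
  `γ(N) = ∂(f(N) × f(N))` and `γ'(N) = γ(N) + N e_k` with `f(N)² ∕ N → 0` (their `f(N) = o(N^{1/(d-1)})`),
  eventually `0 ≤ Cov_β(W_{γ(N)}, W_{γ'(N)}) ≤ e^{-(c/2)N}` — unconditionally for `β > β_c`
  (`znWilsonPairCov_growing_le_exp_of_gt_critical`), modulo DCGR20 Thm 1.1 for `0 < β < β_c`
  (`znWilsonPairCov_growing_le_exp_of_ne_critical_of_DCGR2020`). Their matching LOWER bound
  `e^{-c₁N}` for growing loops (open minimal surface) is NOT formalised here (the tree's
  `znWilsonPairCov_two_translate_ge_exp` is for fixed loops).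

After this file, for `ℤ₂` LGT₃ and rectangular loops in coordinate planes: `ξ_β(γ,γ') > 0` at every
`β > 0` (tree), `ξ_β < ∞` for `β > β_c` and `β < β₀` (tree) and for `β₀ ≤ β < β_c` modulo DCGR20
Thm 1.1 (here) — the named fact `DuminilCopinGoswamiRaoufi2020_truncatedTwoPointPlus_expDecay 3` is
the only unproved input left in census rows A5 ∕ A9 for fixed loops.

HONEST FRAMING: `ℤ₂`, `d = 3`, abelian calibration (cell `ym-ir`); width `0` toward `SU(N)`; nothing
here bears on four-dimensional Yang–Mills or the mass gap (Clay); in the `ym` ladder only the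
conditional finite-`𝕋⁴` rung `BalabanLadder.UV` is closed by any route.

## References

* M. P. Forsström, F. Viklund, arXiv:2502.19942 (2025), Prop. 6.8. [ForsstromViklund2025currents]
* P. Duncan, B. Schweinhart, arXiv:2607.02434 (2026), Thm 8 (p. 4), Prop. 24 (pp. 19–20). [DuncanSchweinhart2026]
* H. Duminil-Copin, S. Goswami, A. Raoufi, Comm. Math. Phys. 374 (2020), Thm 1.1, Lemma 1.2. [DuminilCopinGoswamiRaoufi2020]
* M. Aizenman, Math. Phys. Anal. Geom. 28 (2025), §9.2 Thm 9.2 (2), §9.3. [Aizenman2025]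
* M. Aizenman, D. Barsky, R. Fernández, J. Stat. Phys. 47 (1987), Thm. 1 (sharpness). [AizenmanBarskyFernandezJSP1987]
-/

noncomputable section

open MeasureTheory Finset Filter Topology
open scoped symmDiff
open Literature.Probability.LatticeModels
open Literature.Barriers.QuantumFields (rootsOfUnityCircle znRep)

namespace Literature.MathematicalPhysics.QuantumFieldTheory

open AreaLaw

namespace Z2Duality

/-! ### §1 Flat sheets: distances of dual vertices (as in the deconfined file) -/

section Sheets

variable {x : Probability.LatticeModels.Site 3} {i j : Fin 3} {R T : ℕ}

/-- Membership in the flat sheet. [folklore] -/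
private theorem mem_rectPlaqs_iff' {f : Plaq 3} :
    f ∈ rectPlaqs x i j R T ↔
      ∃ t s : ℕ, t < T ∧ s < R ∧ f = (x + Pi.single j (t : ℤ) + Pi.single i (s : ℤ), i, j) := by
  unfold rectPlaqs
  simp only [Finset.mem_image, Finset.mem_product, Finset.mem_range, Prod.exists]
  constructor
  · rintro ⟨t, s, ⟨ht, hs⟩, rfl⟩; exact ⟨t, s, ht, hs, rfl⟩
  · rintro ⟨t, s, ht, hs, rfl⟩; exact ⟨t, s, ⟨ht, hs⟩, rfl⟩

/-- The upper cube of a face belongs to `verts`. [folklore] -/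
private theorem fst_mem_verts' {U : Finset (Plaq 3)} {f : Plaq 3} (hf : f ∈ U) : f.1 ∈ verts U := by
  unfold verts
  exact Finset.mem_biUnion.2 ⟨f, hf, by simp⟩

/-- `verts` is monotone. [folklore] -/
private theorem verts_mono' {U S : Finset (Plaq 3)} (h : U ⊆ S) : verts U ⊆ verts S :=
  Finset.biUnion_subset_biUnion_of_subset_left _ h

/-- `|verts U| ≤ 2|U|`. [folklore] -/
private theorem card_verts_le' (U : Finset (Plaq 3)) : (verts U).card ≤ 2 * U.card := by
  unfold verts
  calc _ ≤ ∑ f ∈ U, ({lowCube f, f.1} : Finset (Probability.LatticeModels.Site 3)).card :=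
        Finset.card_biUnion_le
    _ ≤ ∑ f ∈ U, 2 := Finset.sum_le_sum fun f _ => Finset.card_le_two
    _ = 2 * U.card := by rw [Finset.sum_const, smul_eq_mul, mul_comm]

/-- `‖c eₖ‖ = |c|` in the sup norm of `ℤ³`. [folklore] -/
private theorem norm_single_intCast' (k : Fin 3) (c : ℤ) :
    ‖(Pi.single k c : Probability.LatticeModels.Site 3)‖ = |(c : ℝ)| := by
  rw [Pi.norm_single, Int.norm_eq_abs]

/-- Dual vertices of a flat sheet are within `R + T + 1` of its base point (sup norm). [folklore] -/
private theorem norm_sub_le_of_mem_verts' {v : Probability.LatticeModels.Site 3}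
    (hv : v ∈ verts (rectPlaqs x i j R T)) : ‖v - x‖ ≤ R + T + 1 := by
  unfold verts at hv
  obtain ⟨f, hf, hvf⟩ := Finset.mem_biUnion.1 hv
  obtain ⟨t, s, ht, hs, rfl⟩ := mem_rectPlaqs_iff'.1 hf
  have ht' : |((t : ℤ) : ℝ)| ≤ T := by
    rw [abs_of_nonneg (by positivity)]; exact_mod_cast ht.le
  have hs' : |((s : ℤ) : ℝ)| ≤ R := by
    rw [abs_of_nonneg (by positivity)]; exact_mod_cast hs.le
  have hn1 : ‖(Pi.single j (t : ℤ) : Probability.LatticeModels.Site 3)‖ ≤ T := by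
    rw [norm_single_intCast']; exact ht'
  have hn2 : ‖(Pi.single i (s : ℤ) : Probability.LatticeModels.Site 3)‖ ≤ R := by
    rw [norm_single_intCast']; exact hs'
  have hn3 : ‖(Pi.single (third i j) (1 : ℤ) : Probability.LatticeModels.Site 3)‖ ≤ 1 := by
    rw [norm_single_intCast']; simp
  have h12 : ‖(Pi.single j (t : ℤ) : Probability.LatticeModels.Site 3) + Pi.single i (s : ℤ)‖ ≤ R + T := by
    have := norm_add_le (Pi.single j (t : ℤ) : Probability.LatticeModels.Site 3) (Pi.single i (s : ℤ))
    linarith only [this, hn1, hn2]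
  have h123 : ‖(Pi.single j (t : ℤ) : Probability.LatticeModels.Site 3) + Pi.single i (s : ℤ) -
      Pi.single (third i j) 1‖ ≤ R + T + 1 := by
    have := norm_sub_le ((Pi.single j (t : ℤ) : Probability.LatticeModels.Site 3) + Pi.single i (s : ℤ))
      (Pi.single (third i j) 1)
    linarith only [this, h12, hn3]
  simp only [Finset.mem_insert, Finset.mem_singleton] at hvf
  rcases hvf with rfl | rfl
  · have heq : lowCube ((x + Pi.single j (t : ℤ) + Pi.single i (s : ℤ), i, j) : Plaq 3) - x =
        Pi.single j (t : ℤ) + Pi.single i (s : ℤ) - Pi.single (third i j) 1 := by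
      simp only [lowCube]; abel
    rw [heq]; exact h123
  · have heq : x + Pi.single j (t : ℤ) + Pi.single i (s : ℤ) - x =
        Pi.single j (t : ℤ) + Pi.single i (s : ℤ) := by abel
    rw [heq]; exact h12.trans (by linarith only)

/-- Dual vertices of two sheets, one translated by `a`, are at sup-distance at least
`‖a‖ - (‖x - x'‖ + (R+T+1) + (R'+T'+1))`. [folklore] -/
private theorem norm_sub_ge_of_mem_verts' {x x' a : Probability.LatticeModels.Site 3} {i j i' j' : Fin 3}
    {R T R' T' : ℕ} {v v' : Probability.LatticeModels.Site 3}
    (hv : v ∈ verts (rectPlaqs x i j R T)) (hv' : v' ∈ verts (rectPlaqs (x' + a) i' j' R' T')) :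
    ‖a‖ - (‖x - x'‖ + (R + T + 1) + (R' + T' + 1)) ≤ ‖v - v'‖ := by
  have h1 := norm_sub_le_of_mem_verts' hv
  have h2 := norm_sub_le_of_mem_verts' hv'
  have key : a = (v - x) + (x - x') - (v' - (x' + a)) - (v - v') := by abel
  have ha : ‖a‖ ≤ ‖v - x‖ + ‖x - x'‖ + ‖v' - (x' + a)‖ + ‖v - v'‖ := by
    calc ‖a‖ = ‖(v - x) + (x - x') - (v' - (x' + a)) - (v - v')‖ := by rw [← key]
      _ ≤ ‖(v - x) + (x - x') - (v' - (x' + a))‖ + ‖v - v'‖ := norm_sub_le _ _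
      _ ≤ ‖(v - x) + (x - x')‖ + ‖v' - (x' + a)‖ + ‖v - v'‖ := by
          have := norm_sub_le ((v - x) + (x - x')) (v' - (x' + a)); linarith
      _ ≤ ‖v - x‖ + ‖x - x'‖ + ‖v' - (x' + a)‖ + ‖v - v'‖ := by
          have := norm_add_le (v - x) (x - x'); linarith
  linarith

/-- Far-apart sheets are disjoint, and so are their dual vertex sets. [folklore] -/
private theorem disjoint_of_far' {x x' a : Probability.LatticeModels.Site 3} {i j i' j' : Fin 3}
    {R T R' T' : ℕ} (ha : ‖x - x'‖ + (R + T + 1) + (R' + T' + 1) < ‖a‖) :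
    Disjoint (rectPlaqs x i j R T) (rectPlaqs (x' + a) i' j' R' T') ∧
      ∀ {U U' : Finset (Plaq 3)}, U ⊆ rectPlaqs x i j R T → U' ⊆ rectPlaqs (x' + a) i' j' R' T' →
        Disjoint (verts U) (verts U') := by
  have hvv : ∀ {v v' : Probability.LatticeModels.Site 3}, v ∈ verts (rectPlaqs x i j R T) →
      v' ∈ verts (rectPlaqs (x' + a) i' j' R' T') → v ≠ v' := by
    intro v v' hv hv' h
    have := norm_sub_ge_of_mem_verts' hv hv'
    rw [h, sub_self, norm_zero] at this
    linarith
  refine ⟨Finset.disjoint_left.2 fun f hf hf' => hvv (fst_mem_verts' hf) (fst_mem_verts' hf') rfl,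
    fun hU hU' => Finset.disjoint_left.2 fun v hv hv' =>
      hvv (verts_mono' hU hv) (verts_mono' hU' hv') rfl⟩

/-- The absolute value of a coefficient of the expansion of `T_{𝒮*}` is at most `cosh(2β)^{|𝒮|}`. [folklore] -/
private theorem abs_coef_le' {b : ℝ} (hb : 0 ≤ b) {S U : Finset (Plaq 3)} (hU : U ⊆ S) :
    |(-Real.sinh (2 * b)) ^ U.card * Real.cosh (2 * b) ^ (S \ U).card| ≤ Real.cosh (2 * b) ^ S.card := by
  have hsh : 0 ≤ Real.sinh (2 * b) := Real.sinh_nonneg_iff.2 (by linarith)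
  have hch : 0 ≤ Real.cosh (2 * b) := (Real.cosh_pos _).le
  have hle : Real.sinh (2 * b) ≤ Real.cosh (2 * b) := (Real.sinh_lt_cosh _).le
  rw [abs_mul, abs_pow, abs_neg, abs_of_nonneg hsh, abs_of_nonneg (pow_nonneg hch _)]
  calc _ ≤ Real.cosh (2 * b) ^ U.card * Real.cosh (2 * b) ^ (S \ U).card :=
        mul_le_mul_of_nonneg_right (pow_le_pow_left₀ hsh hle _) (pow_nonneg hch _)
    _ = Real.cosh (2 * b) ^ S.card := by
        rw [← pow_add, Finset.card_sdiff_of_subset hU, Nat.add_sub_cancel' (Finset.card_le_card hU)]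

/-- A double sum of products `a_U b_{U'} F(U,U')` with `|a_U| ≤ α`, `|b_{U'}| ≤ α'`, `0 ≤ F ≤ Φ`
is at most `|P| |P'| α α' Φ`. [folklore] -/
private theorem sum_sum_mul_mul_le' {ι κ : Type*} (P : Finset ι) (P' : Finset κ) (a : ι → ℝ)
    (b : κ → ℝ) (F : ι → κ → ℝ) {α α' Φ : ℝ} (ha : ∀ U ∈ P, |a U| ≤ α) (hb : ∀ U' ∈ P', |b U'| ≤ α')
    (hF0 : ∀ U ∈ P, ∀ U' ∈ P', 0 ≤ F U U') (hF : ∀ U ∈ P, ∀ U' ∈ P', F U U' ≤ Φ) :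
    ∑ U ∈ P, ∑ U' ∈ P', a U * b U' * F U U' ≤ P.card * P'.card * (α * α' * Φ) := by
  have hterm : ∀ U ∈ P, ∀ U' ∈ P', a U * b U' * F U U' ≤ α * α' * Φ := by
    intro U hU U' hU'
    have h0 := hF0 U hU U' hU'
    have hα : 0 ≤ α := (abs_nonneg _).trans (ha U hU)
    have hα' : 0 ≤ α' := (abs_nonneg _).trans (hb U' hU')
    calc a U * b U' * F U U' ≤ |a U * b U'| * F U U' := mul_le_mul_of_nonneg_right (le_abs_self _) h0
      _ = |a U| * |b U'| * F U U' := by rw [abs_mul]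
      _ ≤ α * α' * Φ := by
          have h1 : |a U| * |b U'| ≤ α * α' := mul_le_mul (ha U hU) (hb U' hU') (abs_nonneg _) hα
          exact mul_le_mul h1 (hF U hU U' hU') h0 (mul_nonneg hα hα')
  calc _ ≤ ∑ U ∈ P, ∑ U' ∈ P', α * α' * Φ :=
        Finset.sum_le_sum fun U hU => Finset.sum_le_sum fun U' hU' => hterm U hU U' hU'
    _ = _ := by simp only [Finset.sum_const, nsmul_eq_mul]; ring

end Sheets

/-! ### §2 From the decay of the truncated two-point function to the decay of `Cov⁺(σ_A, σ_B)` -/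

section PlusCov

/-- **Decay of plus-state covariances of spin products from the decay of the truncated two-point
function** (Duminil-Copin–Goswami–Raoufi 2020, Lemma 1.2, «the truncated two-point function offers a
bound on the decay of more general correlations», through the tree's
`plusCorr_cov_disjoint_le_factorial_mul_sum_truncated`): if `⟨σ_a;σ_b⟩⁺_β ≤ e^{-κ‖a-b‖}` for all
`a, b` (`β, κ ≥ 0`), then for disjoint `A, B` at sup-distance `≥ D`,
`0 ≤ ⟨σ_Aσ_B⟩⁺_β - ⟨σ_A⟩⁺_β⟨σ_B⟩⁺_β ≤ (|A|+|B|)!·|A|·|B|·e^{-κD}`.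
[cite: DuminilCopinGoswamiRaoufi2020, Lemma 1.2 and Thm 1.1] -/
theorem plusCov_decay_of_truncated_decay {β κ : ℝ} (hβ : 0 ≤ β) (hκ : 0 ≤ κ)
    (hdec : ∀ a b : Probability.LatticeModels.Site 3,
      plusCorr 3 β 0 (({a} : Finset (Probability.LatticeModels.Site 3)) ∆ {b}) -
        plusCorr 3 β 0 {a} * plusCorr 3 β 0 {b} ≤ Real.exp (-(κ * ‖a - b‖)))
    (A B : Finset (Probability.LatticeModels.Site 3)) (hAB : Disjoint A B) (D : ℝ)
    (hD : ∀ a ∈ A, ∀ b ∈ B, D ≤ ‖a - b‖) :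
    0 ≤ plusCorr 3 β 0 (A ∆ B) - plusCorr 3 β 0 A * plusCorr 3 β 0 B ∧
      plusCorr 3 β 0 (A ∆ B) - plusCorr 3 β 0 A * plusCorr 3 β 0 B ≤
        ((A.card + B.card).factorial : ℝ) * (A.card * B.card) * Real.exp (-(κ * D)) := by
  obtain ⟨h0, h1⟩ := plusCorr_cov_disjoint_le_factorial_mul_sum_truncated (d := 3) hβ le_rfl hAB
  refine ⟨h0, h1.trans ?_⟩
  rw [mul_assoc]
  refine mul_le_mul_of_nonneg_left ?_ (by positivity)
  calc ∑ a ∈ A, ∑ b ∈ B, (plusCorr 3 β 0 ({a} ∆ {b}) - plusCorr 3 β 0 {a} * plusCorr 3 β 0 {b})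
      ≤ ∑ a ∈ A, ∑ b ∈ B, Real.exp (-(κ * D)) :=
        Finset.sum_le_sum fun a ha => Finset.sum_le_sum fun b hb =>
          (hdec a b).trans (Real.exp_le_exp.2 (by nlinarith [hD a ha b hb]))
    _ = (A.card * B.card) * Real.exp (-(κ * D)) := by
        simp only [Finset.sum_const, nsmul_eq_mul]; ring

end PlusCov

/-! ### §3 The far-loops bound at any `β > 0` whose dual truncated two-point function decays -/

section Far

/-- The combinatorial constant is monotone in the cardinalities. [folklore] -/
private theorem clusterConst_mono' {p q p' q' : ℕ} (hp : p ≤ p') (hq : q ≤ q') :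
    (((p + q).factorial : ℝ) * (p * q)) ≤ (((p' + q').factorial : ℝ) * (p' * q')) := by
  have := Nat.mul_le_mul (Nat.factorial_le (by omega : p + q ≤ p' + q')) (Nat.mul_le_mul hp hq)
  exact_mod_cast this

/-- **The far-loops bound.** For `β > 0` such that the plus state at the dual temperature
`β* = -½ log tanh β` has `⟨σ_a;σ_b⟩⁺_{β*} ≤ e^{-κ‖a-b‖}` (`κ ≥ 0`), flat sheets `𝒮` at `x` and
`𝒮'` at `x' + a` with `‖a‖ > K = ‖x - x'‖ + (R+T+1) + (R'+T'+1)`: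
`⟨W_γ ; W_{γ'+a}⟩_β ≤ 2^{|𝒮|} 2^{|𝒮'|} cosh(2β*)^{|𝒮|+|𝒮'|} (2|𝒮|+2|𝒮'|)!·(2|𝒮|)(2|𝒮'|)·e^{-κ(‖a‖-K)}`
— the duality of truncated correlations (`znWilsonPairCov_eq_sum_plusCov`) and §2 term by term.
[cite: ForsstromViklund2025currents, Prop. 6.8; DuncanSchweinhart2026 Prop. 24 (pp. 19–20, dual-supercritical case); DuminilCopinGoswamiRaoufi2020 Lemma 1.2; Aizenman2025 §9.2 Thm 9.2 (2)] -/
theorem znWilsonPairCov_le_of_truncated_decay_of_far {β : ℝ} (hβ : 0 < β) {κ : ℝ} (hκ : 0 ≤ κ)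
    (hdec : ∀ a b : Probability.LatticeModels.Site 3,
      plusCorr 3 (dualBeta β) 0 (({a} : Finset (Probability.LatticeModels.Site 3)) ∆ {b}) -
        plusCorr 3 (dualBeta β) 0 {a} * plusCorr 3 (dualBeta β) 0 {b} ≤ Real.exp (-(κ * ‖a - b‖)))
    (x x' : Probability.LatticeModels.Site 3) {i j i' j' : Fin 3} (hij : i < j) (hij' : i' < j')
    (R T R' T' : ℕ) {a : Probability.LatticeModels.Site 3}
    (ha : ‖x - x'‖ + (R + T + 1) + (R' + T' + 1) < ‖a‖) :
    znWilsonPairCov 2 β x i j R T (x' + a) i' j' R' T' ≤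
      (2 : ℝ) ^ (rectPlaqs x i j R T).card * (2 : ℝ) ^ (rectPlaqs (x' + a) i' j' R' T').card *
        (Real.cosh (2 * dualBeta β) ^ (rectPlaqs x i j R T).card *
          Real.cosh (2 * dualBeta β) ^ (rectPlaqs (x' + a) i' j' R' T').card *
          ((((2 * (rectPlaqs x i j R T).card + 2 * (rectPlaqs (x' + a) i' j' R' T').card).factorial : ℝ) *
              ((2 * (rectPlaqs x i j R T).card : ℕ) * (2 * (rectPlaqs (x' + a) i' j' R' T').card : ℕ))) *
            Real.exp (-(κ * (‖a‖ - (‖x - x'‖ + (R + T + 1) + (R' + T' + 1))))))) := by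
  have hβs : 0 ≤ dualBeta β := (dualBeta_pos hβ).le
  obtain ⟨hdisj, hvdisj⟩ := disjoint_of_far' (i := i) (j := j) (i' := i') (j' := j') (R := R) (T := T)
    (R' := R') (T' := T') ha
  rw [znWilsonPairCov_eq_sum_plusCov hβ hij hij' hdisj]
  have hc1 : (((rectPlaqs x i j R T).powerset.card : ℕ) : ℝ) = (2 : ℝ) ^ (rectPlaqs x i j R T).card := by
    rw [Finset.card_powerset, Nat.cast_pow, Nat.cast_ofNat]
  have hc2 : (((rectPlaqs (x' + a) i' j' R' T').powerset.card : ℕ) : ℝ) =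
      (2 : ℝ) ^ (rectPlaqs (x' + a) i' j' R' T').card := by
    rw [Finset.card_powerset, Nat.cast_pow, Nat.cast_ofNat]
  rw [← hc1, ← hc2]
  have hclust := plusCov_decay_of_truncated_decay hβs hκ hdec
  refine sum_sum_mul_mul_le' _ _ _ _
    (fun U U' => plusCorr 3 (dualBeta β) 0 (verts U ∆ verts U') -
      plusCorr 3 (dualBeta β) 0 (verts U) * plusCorr 3 (dualBeta β) 0 (verts U'))
    (fun U hU => abs_coef_le' hβs (Finset.mem_powerset.1 hU))
    (fun U' hU' => abs_coef_le' hβs (Finset.mem_powerset.1 hU')) (fun U hU U' hU' => ?_) (fun U hU U' hU' => ?_)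
  · have hU := Finset.mem_powerset.1 hU; have hU' := Finset.mem_powerset.1 hU'
    exact (hclust (verts U) (verts U') (hvdisj hU hU') _
      (fun v hv v' hv' => norm_sub_ge_of_mem_verts' (verts_mono' hU hv) (verts_mono' hU' hv'))).1
  · have hU := Finset.mem_powerset.1 hU; have hU' := Finset.mem_powerset.1 hU'
    refine (hclust (verts U) (verts U') (hvdisj hU hU') _
      (fun v hv v' hv' => norm_sub_ge_of_mem_verts' (verts_mono' hU hv) (verts_mono' hU' hv'))).2.trans ?_
    refine mul_le_mul_of_nonneg_right ?_ (Real.exp_pos _).le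
    have h1 : (verts U).card ≤ 2 * (rectPlaqs x i j R T).card :=
      (card_verts_le' U).trans (Nat.mul_le_mul_left 2 (Finset.card_le_card hU))
    have h2 : (verts U').card ≤ 2 * (rectPlaqs (x' + a) i' j' R' T').card :=
      (card_verts_le' U').trans (Nat.mul_le_mul_left 2 (Finset.card_le_card hU'))
    have := clusterConst_mono' h1 h2
    push_cast at this ⊢
    exact this

end Far

/-! ### §4 Clustering of Wilson loops from the decay of the dual truncated two-point function -/

section Clustering

/-- **Exponential clustering of Wilson loops of `ℤ₂` LGT₃ whenever the dual truncated two-point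
function decays.** For `β > 0` and `c > 0` with `⟨σ_a;σ_b⟩⁺_{β*} ≤ e^{-c‖a-b‖}` for all `a, b`
(plus state of the Ising model on `ℤ³` at `β* = -½ log tanh β`): for all rectangular loops
`γ = ∂(rectPlaqs x i j R T)`, `γ' = ∂(rectPlaqs x' i' j' R' T')` (`i < j`, `i' < j'`) there is `C`
with `0 ≤ ⟨W_γ ; W_{γ'+a}⟩_β ≤ C e^{-c‖a‖}` for every lattice vector `a` (sup norm). Far translates:
§3; nearby translates: `0 ≤ Cov ≤ 1`. [cite: ForsstromViklund2025currents, Prop. 6.8 (d = 3); DuncanSchweinhart2026 Prop. 24 (pp. 19–20); DuminilCopinGoswamiRaoufi2020 Lemma 1.2] -/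
theorem znWilsonPairCov_clustering_of_truncated_decay {β : ℝ} (hβ : 0 < β) {c : ℝ} (hc : 0 < c)
    (hdec : ∀ a b : Probability.LatticeModels.Site 3,
      plusCorr 3 (dualBeta β) 0 (({a} : Finset (Probability.LatticeModels.Site 3)) ∆ {b}) -
        plusCorr 3 (dualBeta β) 0 {a} * plusCorr 3 (dualBeta β) 0 {b} ≤ Real.exp (-(c * ‖a - b‖)))
    (x x' : Probability.LatticeModels.Site 3) {i j i' j' : Fin 3} (hij : i < j) (hij' : i' < j')
    (R T R' T' : ℕ) :
    ∃ C : ℝ, ∀ a : Probability.LatticeModels.Site 3,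
      0 ≤ znWilsonPairCov 2 β x i j R T (x' + a) i' j' R' T' ∧
        znWilsonPairCov 2 β x i j R T (x' + a) i' j' R' T' ≤ C * Real.exp (-(c * ‖a‖)) := by
  have hcardS' : ∀ a : Probability.LatticeModels.Site 3,
      (rectPlaqs (x' + a) i' j' R' T').card = (rectPlaqs x' i' j' R' T').card := by
    intro a
    unfold rectPlaqs
    rw [Finset.card_image_of_injective _ (rectPlaqs_map_injective (x' + a) hij'.ne),
      Finset.card_image_of_injective _ (rectPlaqs_map_injective x' hij'.ne)]
  set K : ℝ := ‖x - x'‖ + (R + T + 1) + (R' + T' + 1) with hK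
  set n₁ := (rectPlaqs x i j R T).card with hn₁
  set n₂ := (rectPlaqs x' i' j' R' T').card with hn₂
  set B : ℝ := (2 : ℝ) ^ n₁ * (2 : ℝ) ^ n₂ *
    (Real.cosh (2 * dualBeta β) ^ n₁ * Real.cosh (2 * dualBeta β) ^ n₂ *
      ((((2 * n₁ + 2 * n₂).factorial : ℝ) * ((2 * n₁ : ℕ) * (2 * n₂ : ℕ))))) with hB
  have hB0 : 0 ≤ B := by
    have := (Real.cosh_pos (2 * dualBeta β)).le
    positivity
  refine ⟨(B + 1) * Real.exp (c * K), fun a => ⟨znWilsonPairCov_nonneg hβ.le _ _ hij.ne hij'.ne _ _ _ _, ?_⟩⟩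
  have hexpK : Real.exp (c * K) * Real.exp (-(c * ‖a‖)) = Real.exp (-(c * (‖a‖ - K))) := by
    rw [← Real.exp_add]; ring_nf
  rcases le_or_gt ‖a‖ K with hle | hfar
  · -- nearby translates: `Cov ≤ 1 ≤ e^{c(K - ‖a‖)}`
    have h1 : znWilsonPairCov 2 β x i j R T (x' + a) i' j' R' T' ≤ 1 :=
      znWilsonPairCov_le_one hβ.le _ _ hij.ne hij'.ne _ _ _ _
    have h2 : (1 : ℝ) ≤ Real.exp (-(c * (‖a‖ - K))) := by
      rw [← Real.exp_zero]; exact Real.exp_le_exp.2 (by nlinarith)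
    have h3 : 0 < Real.exp (-(c * (‖a‖ - K))) := Real.exp_pos _
    calc _ ≤ (1 : ℝ) := h1
      _ ≤ (B + 1) * Real.exp (-(c * (‖a‖ - K))) := by nlinarith
      _ = (B + 1) * (Real.exp (c * K) * Real.exp (-(c * ‖a‖))) := by rw [hexpK]
      _ = (B + 1) * Real.exp (c * K) * Real.exp (-(c * ‖a‖)) := by ring
  · have hmain := znWilsonPairCov_le_of_truncated_decay_of_far hβ hc.le hdec x x' hij hij' R T R' T' hfar
    rw [hcardS' a] at hmain
    have h3 : 0 < Real.exp (-(c * (‖a‖ - K))) := Real.exp_pos _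
    calc _ ≤ B * Real.exp (-(c * (‖a‖ - K))) := by rw [hB, hK]; linarith [hmain]
      _ ≤ (B + 1) * Real.exp (-(c * (‖a‖ - K))) := by nlinarith
      _ = (B + 1) * (Real.exp (c * K) * Real.exp (-(c * ‖a‖))) := by rw [hexpK]
      _ = (B + 1) * Real.exp (c * K) * Real.exp (-(c * ‖a‖)) := by ring

end Clustering

/-! ### §5 The confined phase modulo Duminil-Copin–Goswami–Raoufi 2020 Thm 1.1, and every `β ≠ β_c` -/

section Confined

/-- **Exponential clustering of Wilson loops of `ℤ₂` lattice gauge theory on `ℤ³` in the whole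
CONFINED phase, modulo [DCGR20].** Granting the exponential decay of the truncated two-point function
of the plus state of the Ising model on `ℤ³` for every `β' > β_c^{Ising}` (the shape of
Duminil-Copin–Goswami–Raoufi 2020, Thm 1.1 at `d = 3`): for every `0 < β < β_c = z2GaugeCriticalBetaThree`
there is `m > 0` such that for all rectangular loops `γ = ∂(rectPlaqs x i j R T)`,
`γ' = ∂(rectPlaqs x' i' j' R' T')` in coordinate planes (`i < j`, `i' < j'`) there is `C` with
`0 ≤ ⟨W_γ ; W_{γ'+a}⟩_β ≤ C e^{-m‖a‖}` for every lattice vector `a`. Proof: the confined phase is dual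
to the ORDERED phase, `β* > β_c^{Ising}(ℤ³)` (`criticalBeta_lt_dualBeta`), and §4. (The fixed-loop,
dual-supercritical case of Duncan–Schweinhart's Prop. 24; Forsström–Viklund's Prop. 6.8 proves the
two ends `β` small ∕ large only.) [cite: DuncanSchweinhart2026, Prop. 24 (pp. 19–20) and Thm 8 (p. 4); DuminilCopinGoswamiRaoufi2020 Thm 1.1, Lemma 1.2; ForsstromViklund2025currents Prop. 6.8] -/
theorem znWilsonPairCov_confined_clustering_of_DCGR
    (hDCGR : ∀ β' : ℝ, criticalBeta 3 < β' → ∃ c : ℝ, 0 < c ∧ ∀ a b : Probability.LatticeModels.Site 3,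
      plusCorr 3 β' 0 (({a} : Finset (Probability.LatticeModels.Site 3)) ∆ {b}) -
        plusCorr 3 β' 0 {a} * plusCorr 3 β' 0 {b} ≤ Real.exp (-(c * ‖a - b‖)))
    {β : ℝ} (hβ : 0 < β) (hlt : β < z2GaugeCriticalBetaThree) :
    ∃ m : ℝ, 0 < m ∧ ∀ (x x' : Probability.LatticeModels.Site 3) (i j i' j' : Fin 3), i < j → i' < j' →
      ∀ (R T R' T' : ℕ), ∃ C : ℝ, ∀ a : Probability.LatticeModels.Site 3,
        0 ≤ znWilsonPairCov 2 β x i j R T (x' + a) i' j' R' T' ∧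
        znWilsonPairCov 2 β x i j R T (x' + a) i' j' R' T' ≤ C * Real.exp (-(m * ‖a‖)) := by
  obtain ⟨c, hc, hdec⟩ := hDCGR (dualBeta β) (criticalBeta_lt_dualBeta hβ hlt)
  exact ⟨c, hc, fun x x' i j i' j' hij hij' R T R' T' =>
    znWilsonPairCov_clustering_of_truncated_decay hβ hc hdec x x' hij hij' R T R' T'⟩

/-- **Exponential clustering of Wilson loops of `ℤ₂` LGT₃ at EVERY `β ≠ β_c`, modulo [DCGR20]**
(`β > 0`): the confined phase by `znWilsonPairCov_confined_clustering_of_DCGR`, the deconfined phase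
unconditionally by the tree's `znWilsonPairCov_deconfined_clustering`. This is Forsström–Viklund's
Prop. 6.8 for `d = 3`, `G = ℤ₂` and the fixed-loop case of Duncan–Schweinhart's Prop. 24 ∕ Thm 8 at
every non-critical coupling, the critical point being `β_c = artanh e^{-2β_c^{Ising}(ℤ³)}`.
[cite: ForsstromViklund2025currents, Prop. 6.8; DuncanSchweinhart2026 Thm 8 (p. 4), Prop. 24 (pp. 19–20); DuminilCopinGoswamiRaoufi2020 Thm 1.1] -/
theorem znWilsonPairCov_clustering_of_ne_critical_of_DCGR
    (hDCGR : ∀ β' : ℝ, criticalBeta 3 < β' → ∃ c : ℝ, 0 < c ∧ ∀ a b : Probability.LatticeModels.Site 3,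
      plusCorr 3 β' 0 (({a} : Finset (Probability.LatticeModels.Site 3)) ∆ {b}) -
        plusCorr 3 β' 0 {a} * plusCorr 3 β' 0 {b} ≤ Real.exp (-(c * ‖a - b‖)))
    {β : ℝ} (hβ : 0 < β) (hne : β ≠ z2GaugeCriticalBetaThree) :
    ∃ m : ℝ, 0 < m ∧ ∀ (x x' : Probability.LatticeModels.Site 3) (i j i' j' : Fin 3), i < j → i' < j' →
      ∀ (R T R' T' : ℕ), ∃ C : ℝ, ∀ a : Probability.LatticeModels.Site 3,
        0 ≤ znWilsonPairCov 2 β x i j R T (x' + a) i' j' R' T' ∧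
        znWilsonPairCov 2 β x i j R T (x' + a) i' j' R' T' ≤ C * Real.exp (-(m * ‖a‖)) := by
  rcases lt_or_gt_of_ne hne with hlt | hgt
  · exact znWilsonPairCov_confined_clustering_of_DCGR hDCGR hβ hlt
  · exact znWilsonPairCov_deconfined_clustering hgt

/-- **The confined-phase clustering from the tree's named fact
`DuminilCopinGoswamiRaoufi2020_truncatedTwoPointPlus_expDecay 3`.**
[cite: DuncanSchweinhart2026, Prop. 24 (pp. 19–20); DuminilCopinGoswamiRaoufi2020 Thm 1.1] -/
theorem znWilsonPairCov_confined_clustering_of_DCGR2020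
    (h : DuminilCopinGoswamiRaoufi2020_truncatedTwoPointPlus_expDecay 3) {β : ℝ} (hβ : 0 < β)
    (hlt : β < z2GaugeCriticalBetaThree) :
    ∃ m : ℝ, 0 < m ∧ ∀ (x x' : Probability.LatticeModels.Site 3) (i j i' j' : Fin 3), i < j → i' < j' →
      ∀ (R T R' T' : ℕ), ∃ C : ℝ, ∀ a : Probability.LatticeModels.Site 3,
        0 ≤ znWilsonPairCov 2 β x i j R T (x' + a) i' j' R' T' ∧
        znWilsonPairCov 2 β x i j R T (x' + a) i' j' R' T' ≤ C * Real.exp (-(m * ‖a‖)) :=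
  znWilsonPairCov_confined_clustering_of_DCGR (dcgr2020_three_upper h) hβ hlt

/-- **Forsström–Viklund 2025 Prop. 6.8 (`d = 3`, `G = ℤ₂`) ∕ Duncan–Schweinhart 2026 Prop. 24 (fixed
loops) at every `β ≠ β_c`, from the tree's named fact DCGR20 Thm 1.1** (`β > 0`): exponential
clustering of all pairs of rectangular Wilson loops in coordinate planes — the deconfined side
unconditionally, the confined side modulo the fact. [cite: ForsstromViklund2025currents, Prop. 6.8; DuncanSchweinhart2026 Prop. 24 (pp. 19–20), Thm 8 (p. 4); DuminilCopinGoswamiRaoufi2020 Thm 1.1] -/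
theorem znWilsonPairCov_clustering_of_ne_critical_of_DCGR2020
    (h : DuminilCopinGoswamiRaoufi2020_truncatedTwoPointPlus_expDecay 3) {β : ℝ} (hβ : 0 < β)
    (hne : β ≠ z2GaugeCriticalBetaThree) :
    ∃ m : ℝ, 0 < m ∧ ∀ (x x' : Probability.LatticeModels.Site 3) (i j i' j' : Fin 3), i < j → i' < j' →
      ∀ (R T R' T' : ℕ), ∃ C : ℝ, ∀ a : Probability.LatticeModels.Site 3,
        0 ≤ znWilsonPairCov 2 β x i j R T (x' + a) i' j' R' T' ∧
        znWilsonPairCov 2 β x i j R T (x' + a) i' j' R' T' ≤ C * Real.exp (-(m * ‖a‖)) :=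
  znWilsonPairCov_clustering_of_ne_critical_of_DCGR (dcgr2020_three_upper h) hβ hne

end Confined

/-! ### §6 Two-sided bounds for translates `γ' = γ + N e_k` -/

section TwoSided

variable {i j : Fin 3}

/-- **Two-sided exponential bounds in the confined phase, every rectangular loop, modulo [DCGR20]**
(`ℤ₂` LGT on `ℤ³`, `0 < β < β_c`; Duncan–Schweinhart 2026 Prop. 24, fixed loops, dual-supercritical
case): granting DCGR20 Thm 1.1 at `d = 3`, for `i < j`, `R, T ≥ 1` there are `c₁, m > 0` and `C` with
`e^{-c₁N} ≤ ⟨W_γ ; W_{γ+Ne_k}⟩_β ≤ C e^{-mN}` for all `x`, `N ≥ 1` (`k = third i j`) — the lower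
bound is the tree's `znWilsonPairCov_two_translate_ge_exp` (every `β > 0`), the upper bound §5.
[cite: DuncanSchweinhart2026, Prop. 24 (pp. 19–20) and Thm 8 (p. 4); DuminilCopinGoswamiRaoufi2020 Thm 1.1] -/
theorem znWilsonPairCov_two_translate_two_sided_of_lt_critical_of_DCGR2020
    (h : DuminilCopinGoswamiRaoufi2020_truncatedTwoPointPlus_expDecay 3) {β : ℝ} (hβ : 0 < β)
    (hlt : β < z2GaugeCriticalBetaThree) (hij : i < j) {R T : ℕ} (hR : 1 ≤ R) (hT : 1 ≤ T) :
    ∃ c₁ m C : ℝ, 0 < c₁ ∧ 0 < m ∧ ∀ (x : Probability.LatticeModels.Site 3) (N : ℕ), 1 ≤ N →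
      Real.exp (-(c₁ * N)) ≤ znWilsonPairCov 2 β x i j R T (x + Pi.single (third i j) (N : ℤ)) i j R T ∧
        znWilsonPairCov 2 β x i j R T (x + Pi.single (third i j) (N : ℤ)) i j R T ≤
          C * Real.exp (-(m * N)) := by
  obtain ⟨c₁, hc₁, hlow⟩ := znWilsonPairCov_two_translate_ge_exp hβ hij hR hT
  obtain ⟨m, hm, hup⟩ := znWilsonPairCov_confined_clustering_of_DCGR2020 h hβ hlt
  obtain ⟨C, hC⟩ := hup 0 0 i j i j hij hij R T R T
  refine ⟨c₁, m, C, hc₁, hm, fun x N hN => ⟨hlow x N hN, ?_⟩⟩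
  have htr := znWilsonPairCov_add_eq (n := 2) hβ.le 0 (Pi.single (third i j) (N : ℤ)) x
    hij.ne hij.ne R T R T
  rw [zero_add, add_comm] at htr
  rw [htr]
  have h2 := (hC (Pi.single (third i j) (N : ℤ))).2
  rw [zero_add, Pi.norm_single, Int.norm_natCast] at h2
  exact h2

/-- **Two-sided exponential bounds at every `β ≠ β_c`, every rectangular loop, modulo [DCGR20]**
(`β > 0`; `0 < ξ_β(γ) < ∞` off criticality — Duncan–Schweinhart 2026 Thm 8 ∕ Prop. 24 for fixed
rectangular loops of `ℤ₂` LGT₃): the deconfined side is the tree's unconditional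
`znWilsonPairCov_two_translate_two_sided_of_gt_critical`, the confined side the previous theorem.
[cite: DuncanSchweinhart2026, Thm 8 (p. 4), Prop. 24 (pp. 19–20); DuminilCopinGoswamiRaoufi2020 Thm 1.1; ForsstromViklund2025currents Prop. 6.8] -/
theorem znWilsonPairCov_two_translate_two_sided_of_ne_critical_of_DCGR2020
    (h : DuminilCopinGoswamiRaoufi2020_truncatedTwoPointPlus_expDecay 3) {β : ℝ} (hβ : 0 < β)
    (hne : β ≠ z2GaugeCriticalBetaThree) (hij : i < j) {R T : ℕ} (hR : 1 ≤ R) (hT : 1 ≤ T) :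
    ∃ c₁ m C : ℝ, 0 < c₁ ∧ 0 < m ∧ ∀ (x : Probability.LatticeModels.Site 3) (N : ℕ), 1 ≤ N →
      Real.exp (-(c₁ * N)) ≤ znWilsonPairCov 2 β x i j R T (x + Pi.single (third i j) (N : ℤ)) i j R T ∧
        znWilsonPairCov 2 β x i j R T (x + Pi.single (third i j) (N : ℤ)) i j R T ≤
          C * Real.exp (-(m * N)) := by
  rcases lt_or_gt_of_ne hne with hlt | hgt
  · exact znWilsonPairCov_two_translate_two_sided_of_lt_critical_of_DCGR2020 h hβ hlt hij hR hT
  · exact znWilsonPairCov_two_translate_two_sided_of_gt_critical hgt hij hR hT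

end TwoSided

/-! ### §7 Sharp constants: Lemma 1.2 with constant `1` -/

section Sharp

/-- **Decay of plus-state covariances of spin products, SHARP form**: if `⟨σ_a;σ_b⟩⁺_β ≤ e^{-κ‖a-b‖}`
for all `a, b` (`β, κ ≥ 0`), then for disjoint `A, B` at sup-distance `≥ D`,
`0 ≤ ⟨σ_Aσ_B⟩⁺_β - ⟨σ_A⟩⁺_β⟨σ_B⟩⁺_β ≤ |A|·|B|·e^{-κD}` (the tree's Lemma 1.2 with constant `1`,
`plusCorr_cov_disjoint_le_sum_truncated`). [cite: DuminilCopinGoswamiRaoufi2020, Lemma 1.2 and Thm 1.1] -/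
theorem plusCov_decay_of_truncated_decay_sharp {β κ : ℝ} (hβ : 0 ≤ β) (hκ : 0 ≤ κ)
    (hdec : ∀ a b : Probability.LatticeModels.Site 3,
      plusCorr 3 β 0 (({a} : Finset (Probability.LatticeModels.Site 3)) ∆ {b}) -
        plusCorr 3 β 0 {a} * plusCorr 3 β 0 {b} ≤ Real.exp (-(κ * ‖a - b‖)))
    (A B : Finset (Probability.LatticeModels.Site 3)) (hAB : Disjoint A B) (D : ℝ)
    (hD : ∀ a ∈ A, ∀ b ∈ B, D ≤ ‖a - b‖) :
    0 ≤ plusCorr 3 β 0 (A ∆ B) - plusCorr 3 β 0 A * plusCorr 3 β 0 B ∧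
      plusCorr 3 β 0 (A ∆ B) - plusCorr 3 β 0 A * plusCorr 3 β 0 B ≤
        ((A.card : ℝ) * B.card) * Real.exp (-(κ * D)) := by
  obtain ⟨h0, h1⟩ := plusCorr_cov_disjoint_le_sum_truncated (d := 3) hβ le_rfl hAB
  refine ⟨h0, h1.trans ?_⟩
  calc ∑ a ∈ A, ∑ b ∈ B, (plusCorr 3 β 0 ({a} ∆ {b}) - plusCorr 3 β 0 {a} * plusCorr 3 β 0 {b})
      ≤ ∑ a ∈ A, ∑ b ∈ B, Real.exp (-(κ * D)) :=
        Finset.sum_le_sum fun a ha => Finset.sum_le_sum fun b hb =>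
          (hdec a b).trans (Real.exp_le_exp.2 (by nlinarith [hD a ha b hb]))
    _ = ((A.card : ℝ) * B.card) * Real.exp (-(κ * D)) := by
        simp only [Finset.sum_const, nsmul_eq_mul]; ring

/-- **The far-loops bound, SHARP form** (`β > 0`, `⟨σ_a;σ_b⟩⁺_{β*} ≤ e^{-κ‖a-b‖}`, `κ ≥ 0`, flat
sheets `𝒮` at `x` and `𝒮'` at `x' + a`, `‖a‖ > K = ‖x - x'‖ + (R+T+1) + (R'+T'+1)`):
`⟨W_γ ; W_{γ'+a}⟩_β ≤ 2^{|𝒮|} 2^{|𝒮'|} cosh(2β*)^{|𝒮|+|𝒮'|} (2|𝒮|)(2|𝒮'|) e^{-κ(‖a‖-K)}` — §3 without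
the factorial. [cite: DuncanSchweinhart2026, Prop. 24 (pp. 19–20); DuminilCopinGoswamiRaoufi2020 Lemma 1.2; Aizenman2025 §9.2 Thm 9.2 (2)] -/
theorem znWilsonPairCov_le_of_truncated_decay_of_far_sharp {β : ℝ} (hβ : 0 < β) {κ : ℝ} (hκ : 0 ≤ κ)
    (hdec : ∀ a b : Probability.LatticeModels.Site 3,
      plusCorr 3 (dualBeta β) 0 (({a} : Finset (Probability.LatticeModels.Site 3)) ∆ {b}) -
        plusCorr 3 (dualBeta β) 0 {a} * plusCorr 3 (dualBeta β) 0 {b} ≤ Real.exp (-(κ * ‖a - b‖)))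
    (x x' : Probability.LatticeModels.Site 3) {i j i' j' : Fin 3} (hij : i < j) (hij' : i' < j')
    (R T R' T' : ℕ) {a : Probability.LatticeModels.Site 3}
    (ha : ‖x - x'‖ + (R + T + 1) + (R' + T' + 1) < ‖a‖) :
    znWilsonPairCov 2 β x i j R T (x' + a) i' j' R' T' ≤
      (2 : ℝ) ^ (rectPlaqs x i j R T).card * (2 : ℝ) ^ (rectPlaqs (x' + a) i' j' R' T').card *
        (Real.cosh (2 * dualBeta β) ^ (rectPlaqs x i j R T).card *
          Real.cosh (2 * dualBeta β) ^ (rectPlaqs (x' + a) i' j' R' T').card *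
          ((((2 * (rectPlaqs x i j R T).card : ℕ) : ℝ) * ((2 * (rectPlaqs (x' + a) i' j' R' T').card : ℕ) : ℝ)) *
            Real.exp (-(κ * (‖a‖ - (‖x - x'‖ + (R + T + 1) + (R' + T' + 1))))))) := by
  have hβs : 0 ≤ dualBeta β := (dualBeta_pos hβ).le
  obtain ⟨hdisj, hvdisj⟩ := disjoint_of_far' (i := i) (j := j) (i' := i') (j' := j') (R := R) (T := T)
    (R' := R') (T' := T') ha
  rw [znWilsonPairCov_eq_sum_plusCov hβ hij hij' hdisj]
  have hc1 : (((rectPlaqs x i j R T).powerset.card : ℕ) : ℝ) = (2 : ℝ) ^ (rectPlaqs x i j R T).card := by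
    rw [Finset.card_powerset, Nat.cast_pow, Nat.cast_ofNat]
  have hc2 : (((rectPlaqs (x' + a) i' j' R' T').powerset.card : ℕ) : ℝ) =
      (2 : ℝ) ^ (rectPlaqs (x' + a) i' j' R' T').card := by
    rw [Finset.card_powerset, Nat.cast_pow, Nat.cast_ofNat]
  rw [← hc1, ← hc2]
  have hclust := plusCov_decay_of_truncated_decay_sharp hβs hκ hdec
  refine sum_sum_mul_mul_le' _ _ _ _
    (fun U U' => plusCorr 3 (dualBeta β) 0 (verts U ∆ verts U') -
      plusCorr 3 (dualBeta β) 0 (verts U) * plusCorr 3 (dualBeta β) 0 (verts U'))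
    (fun U hU => abs_coef_le' hβs (Finset.mem_powerset.1 hU))
    (fun U' hU' => abs_coef_le' hβs (Finset.mem_powerset.1 hU')) (fun U hU U' hU' => ?_) (fun U hU U' hU' => ?_)
  · have hU := Finset.mem_powerset.1 hU; have hU' := Finset.mem_powerset.1 hU'
    exact (hclust (verts U) (verts U') (hvdisj hU hU') _
      (fun v hv v' hv' => norm_sub_ge_of_mem_verts' (verts_mono' hU hv) (verts_mono' hU' hv'))).1
  · have hU := Finset.mem_powerset.1 hU; have hU' := Finset.mem_powerset.1 hU'
    refine (hclust (verts U) (verts U') (hvdisj hU hU') _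
      (fun v hv v' hv' => norm_sub_ge_of_mem_verts' (verts_mono' hU hv) (verts_mono' hU' hv'))).2.trans ?_
    refine mul_le_mul_of_nonneg_right ?_ (Real.exp_pos _).le
    have h1 : (verts U).card ≤ 2 * (rectPlaqs x i j R T).card :=
      (card_verts_le' U).trans (Nat.mul_le_mul_left 2 (Finset.card_le_card hU))
    have h2 : (verts U').card ≤ 2 * (rectPlaqs (x' + a) i' j' R' T').card :=
      (card_verts_le' U').trans (Nat.mul_le_mul_left 2 (Finset.card_le_card hU'))
    exact_mod_cast Nat.mul_le_mul h1 h2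

end Sharp

/-! ### §8 The dual input in the deconfined phase as a truncated-two-point bound -/

section DualInput

/-- **Sharpness, truncated form, free state** (`d ≥ 2`, `0 ≤ β' < β_c^{Ising}(ℤ^d)`): there is
`κ > 0` with `⟨σ_aσ_b⟩^∅_{β'} - ⟨σ_a⟩^∅_{β'}⟨σ_b⟩^∅_{β'} ≤ e^{-κ‖a-b‖}` for all `a, b` — the free state
is even (`⟨σ_a⟩^∅ = 0`), translation invariant, and `⟨σ₀σ_v⟩^∅_{β'} ≤ e^{-κ‖v‖}`
(`twoPoint_exponentialDecay_of_lt_criticalBeta_holds`). [cite: AizenmanBarskyFernandezJSP1987, Thm. 1] -/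
theorem freeCorr_truncatedTwoPoint_expDecay_of_lt_criticalBeta {d : ℕ} (hd : 2 ≤ d) {β' : ℝ}
    (hβ' : 0 ≤ β') (hlt : β' < criticalBeta d) :
    ∃ κ : ℝ, 0 < κ ∧ ∀ a b : Probability.LatticeModels.Site d,
      freeCorr d β' 0 (({a} : Finset (Probability.LatticeModels.Site d)) ∆ {b}) -
        freeCorr d β' 0 {a} * freeCorr d β' 0 {b} ≤ Real.exp (-(κ * ‖a - b‖)) := by
  obtain ⟨κ, hκ, hdec⟩ := twoPoint_exponentialDecay_of_lt_criticalBeta_holds (d := d) hd hβ' hlt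
  refine ⟨κ, hκ, fun a b => ?_⟩
  rw [freeCorr_singleton_eq_zero hβ' a, zero_mul, sub_zero]
  by_cases hab : a = b
  · subst hab
    rw [symmDiff_self, Finset.bot_eq_empty, freeCorr_empty hβ' le_rfl, sub_self, norm_zero, mul_zero,
      neg_zero, Real.exp_zero]
  · set v : Probability.LatticeModels.Site d := b - a with hv
    have hv0 : v ≠ 0 := sub_ne_zero.2 (Ne.symm hab)
    have hb : b = a + v := by rw [hv]; abel
    have hne : a ≠ a + v := by rw [← hb]; exact hab
    have hpair : (({a} : Finset (Probability.LatticeModels.Site d)) ∆ {b}) = {a, a + v} := by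
      rw [hb]
      ext z
      simp only [Finset.mem_symmDiff, Finset.mem_singleton, Finset.mem_insert]
      constructor
      · rintro (⟨h1, -⟩ | ⟨h1, -⟩)
        · exact Or.inl h1
        · exact Or.inr h1
      · rintro (rfl | rfl)
        · exact Or.inl ⟨rfl, hne⟩
        · exact Or.inr ⟨rfl, fun h => hne h.symm⟩
    rw [hpair, freeCorr_pair_shift hβ' a v, ← twoPointFree_eq_freeCorr _ hv0]
    refine (hdec v).trans (le_of_eq ?_)
    rw [hv, norm_sub_rev, neg_mul]

/-- **The dual input in the DECONFINED phase**: for `β > β_c = z2GaugeCriticalBetaThree` the plus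
state of the Ising model on `ℤ³` at `β* = -½ log tanh β < β_c^{Ising}` has an exponentially decaying
truncated two-point function, `⟨σ_a;σ_b⟩⁺_{β*} ≤ e^{-κ‖a-b‖}` (`κ > 0`): plus = free at `β*`
(`plusCorr_dualBeta_eq_freeCorr`) and sharpness. [cite: AizenmanBarskyFernandezJSP1987, Thm. 1; Aizenman2025 §9.3] -/
theorem plusCorr_truncatedTwoPoint_dualBeta_expDecay_of_gt_critical {β : ℝ}
    (h : z2GaugeCriticalBetaThree < β) :
    ∃ κ : ℝ, 0 < κ ∧ ∀ a b : Probability.LatticeModels.Site 3,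
      plusCorr 3 (dualBeta β) 0 (({a} : Finset (Probability.LatticeModels.Site 3)) ∆ {b}) -
        plusCorr 3 (dualBeta β) 0 {a} * plusCorr 3 (dualBeta β) 0 {b} ≤ Real.exp (-(κ * ‖a - b‖)) := by
  have hβ : 0 < β := z2GaugeCriticalBetaThree_pos.trans h
  obtain ⟨κ, hκ, hdec⟩ := freeCorr_truncatedTwoPoint_expDecay_of_lt_criticalBeta (d := 3) (by norm_num)
    (dualBeta_pos hβ).le (dualBeta_lt_criticalBeta h)
  refine ⟨κ, hκ, fun a b => ?_⟩
  rw [plusCorr_dualBeta_eq_freeCorr h, plusCorr_dualBeta_eq_freeCorr h, plusCorr_dualBeta_eq_freeCorr h]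
  exact hdec a b

/-- **The dual input at every `β ≠ β_c`, modulo [DCGR20]** (`β > 0`): exponential decay of the
truncated two-point function of the plus state at `β*` — for `β < β_c` from the granted decay above
`β_c^{Ising}` (`β* > β_c^{Ising}`, `criticalBeta_lt_dualBeta`), for `β > β_c` unconditionally (§8).
[cite: DuminilCopinGoswamiRaoufi2020, Thm 1.1; AizenmanBarskyFernandezJSP1987 Thm. 1] -/
theorem plusCorr_truncatedTwoPoint_dualBeta_expDecay_of_ne_critical_of_DCGR
    (hDCGR : ∀ β' : ℝ, criticalBeta 3 < β' → ∃ c : ℝ, 0 < c ∧ ∀ a b : Probability.LatticeModels.Site 3,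
      plusCorr 3 β' 0 (({a} : Finset (Probability.LatticeModels.Site 3)) ∆ {b}) -
        plusCorr 3 β' 0 {a} * plusCorr 3 β' 0 {b} ≤ Real.exp (-(c * ‖a - b‖)))
    {β : ℝ} (hβ : 0 < β) (hne : β ≠ z2GaugeCriticalBetaThree) :
    ∃ c : ℝ, 0 < c ∧ ∀ a b : Probability.LatticeModels.Site 3,
      plusCorr 3 (dualBeta β) 0 (({a} : Finset (Probability.LatticeModels.Site 3)) ∆ {b}) -
        plusCorr 3 (dualBeta β) 0 {a} * plusCorr 3 (dualBeta β) 0 {b} ≤ Real.exp (-(c * ‖a - b‖)) := by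
  rcases lt_or_gt_of_ne hne with hlt | hgt
  · exact hDCGR (dualBeta β) (criticalBeta_lt_dualBeta hβ hlt)
  · exact plusCorr_truncatedTwoPoint_dualBeta_expDecay_of_gt_critical hgt

end DualInput

/-! ### §9 Growing loops: Duncan–Schweinhart 2026 Prop. 24, upper bound, `q = 2`, `d = 3` -/

section Growing

variable {i j : Fin 3}

/-- `#(rectPlaqs x i j R T) = R T` (`i ≠ j`). [folklore] -/
private theorem card_rectPlaqs_eq' (x : Probability.LatticeModels.Site 3) (hij : i ≠ j) (R T : ℕ) :
    (rectPlaqs x i j R T).card = R * T := by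
  unfold rectPlaqs
  rw [Finset.card_image_of_injective _ (rectPlaqs_map_injective x hij), Finset.card_product,
    Finset.card_range, Finset.card_range, mul_comm]

/-- **Square loops and their far translates, explicit bound** (`β > 0`, `⟨σ_a;σ_b⟩⁺_{β*} ≤ e^{-κ‖a-b‖}`,
`κ ≥ 0`, `i < j`, `k = third i j`, side `s`, `4s + 2 < N`): for `γ = ∂(rectPlaqs x i j s s)` and
`γ' = γ + N e_k`,
`⟨W_γ ; W_{γ'}⟩_β ≤ 2^{s²} 2^{s²} cosh(2β*)^{s²} cosh(2β*)^{s²} (2s²)(2s²) e^{-κ(N - (4s+2))}`.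
[cite: DuncanSchweinhart2026, Prop. 24 (pp. 19–20)] -/
theorem znWilsonPairCov_square_translate_le_of_truncated_decay {β : ℝ} (hβ : 0 < β) {κ : ℝ}
    (hκ : 0 ≤ κ)
    (hdec : ∀ a b : Probability.LatticeModels.Site 3,
      plusCorr 3 (dualBeta β) 0 (({a} : Finset (Probability.LatticeModels.Site 3)) ∆ {b}) -
        plusCorr 3 (dualBeta β) 0 {a} * plusCorr 3 (dualBeta β) 0 {b} ≤ Real.exp (-(κ * ‖a - b‖)))
    (hij : i < j) (x : Probability.LatticeModels.Site 3) {s N : ℕ} (hN : (4 * s + 2 : ℝ) < N) :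
    znWilsonPairCov 2 β x i j s s (x + Pi.single (third i j) (N : ℤ)) i j s s ≤
      (2 : ℝ) ^ (s * s) * (2 : ℝ) ^ (s * s) *
        (Real.cosh (2 * dualBeta β) ^ (s * s) * Real.cosh (2 * dualBeta β) ^ (s * s) *
          ((((2 * (s * s) : ℕ) : ℝ) * ((2 * (s * s) : ℕ) : ℝ)) *
            Real.exp (-(κ * (N - ((s + s + 1) + (s + s + 1))))))) := by
  have ha : ‖x - x‖ + (s + s + 1) + (s + s + 1) <
      ‖(Pi.single (third i j) (N : ℤ) : Probability.LatticeModels.Site 3)‖ := by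
    rw [sub_self, norm_zero, Pi.norm_single, Int.norm_natCast]; linarith
  have h := znWilsonPairCov_le_of_truncated_decay_of_far_sharp hβ hκ hdec x x hij hij s s s s ha
  rw [card_rectPlaqs_eq' x hij.ne, card_rectPlaqs_eq' _ hij.ne, sub_self, norm_zero, Pi.norm_single,
    Int.norm_natCast, zero_add] at h
  exact h

/-- **Duncan–Schweinhart 2026, Prop. 24 — UPPER bound for GROWING loops of `ℤ₂` lattice gauge theory
on `ℤ³`, at every `β > 0` at whose dual temperature the truncated two-point function decays.** Let
`⟨σ_a;σ_b⟩⁺_{β*} ≤ e^{-c‖a-b‖}` (`c > 0`), `i < j`, `k = third i j`, and `f : ℕ → ℕ` with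
`f(N)² ∕ N → 0` (their hypothesis `f(N) = o(N^{1/(d-1)})`, `d = 3`). For the square loops
`γ(N) = ∂(rectPlaqs x i j f(N) f(N))` and `γ'(N) = γ(N) + N e_k` (for `x = 0`, `(i,j) = (0,1)`:
`γ(N) = ∂([0,f(N)]² × {0})`, `γ'(N) = ∂([0,f(N)]² × {N})`), eventually in `N`, uniformly in `x`,
`0 ≤ Cov_β(W_{γ(N)}, W_{γ'(N)}) ≤ e^{-(c/2)N}`. Proof: §9's explicit bound, whose prefactor is
`e^{O(f(N)²)} = e^{o(N)}` thanks to the sharp Lemma 1.2. (The printed matching lower bound `e^{-c₁N}`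
is not formalised here.) [cite: DuncanSchweinhart2026, Prop. 24 (pp. 19–20) and Thm 8 (p. 4)] -/
theorem znWilsonPairCov_growing_le_exp_of_truncated_decay {β : ℝ} (hβ : 0 < β) {c : ℝ} (hc : 0 < c)
    (hdec : ∀ a b : Probability.LatticeModels.Site 3,
      plusCorr 3 (dualBeta β) 0 (({a} : Finset (Probability.LatticeModels.Site 3)) ∆ {b}) -
        plusCorr 3 (dualBeta β) 0 {a} * plusCorr 3 (dualBeta β) 0 {b} ≤ Real.exp (-(c * ‖a - b‖)))
    (hij : i < j) {f : ℕ → ℕ} (hf : Tendsto (fun N : ℕ => ((f N : ℝ) ^ 2) / N) atTop (𝓝 0)) :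
    ∀ᶠ N : ℕ in atTop, ∀ x : Probability.LatticeModels.Site 3,
      0 ≤ znWilsonPairCov 2 β x i j (f N) (f N) (x + Pi.single (third i j) (N : ℤ)) i j (f N) (f N) ∧
        znWilsonPairCov 2 β x i j (f N) (f N) (x + Pi.single (third i j) (N : ℤ)) i j (f N) (f N) ≤
          Real.exp (-(c / 2 * N)) := by
  -- the rate of the prefactor: `e^{L f(N)²}`
  have hlog2 : 0 < Real.log 2 := Real.log_pos one_lt_two
  have hcosh : 0 < Real.cosh (2 * dualBeta β) := Real.cosh_pos _
  have hlogc : 0 ≤ Real.log (Real.cosh (2 * dualBeta β)) := Real.log_nonneg (Real.one_le_cosh _)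
  have hL0 : 0 < Real.log 2 * 2 + Real.log (Real.cosh (2 * dualBeta β)) * 2 + 4 + 4 * c := by positivity
  have hε : 0 < c / (4 * (Real.log 2 * 2 + Real.log (Real.cosh (2 * dualBeta β)) * 2 + 4 + 4 * c)) := by
    positivity
  filter_upwards [hf.eventually (gt_mem_nhds hε), eventually_ge_atTop 8] with N h1 hN8 x
  refine ⟨znWilsonPairCov_nonneg hβ.le _ _ hij.ne hij.ne _ _ _ _, ?_⟩
  have hN8r : (8 : ℝ) ≤ N := by exact_mod_cast hN8
  have hNpos : (0 : ℝ) < N := by linarith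
  set s := f N with hs
  set n : ℝ := ((s * s : ℕ) : ℝ) with hn
  have hn_sq : ((s : ℝ) ^ 2) = n := by rw [hn]; push_cast; ring
  have hn0 : 0 ≤ n := by rw [hn]; positivity
  have hsn : (s : ℝ) ≤ n := by rw [hn]; exact_mod_cast Nat.le_mul_self s
  have hlt : n < c / (4 * (Real.log 2 * 2 + Real.log (Real.cosh (2 * dualBeta β)) * 2 + 4 + 4 * c)) * N := by
    rw [← hn_sq]; exact (div_lt_iff₀ hNpos).1 h1
  have hnL : n * (Real.log 2 * 2 + Real.log (Real.cosh (2 * dualBeta β)) * 2 + 4 + 4 * c) < c * N / 4 := by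
    have h := mul_lt_mul_of_pos_right hlt hL0
    calc _ < c / (4 * (Real.log 2 * 2 + Real.log (Real.cosh (2 * dualBeta β)) * 2 + 4 + 4 * c)) * N *
          (Real.log 2 * 2 + Real.log (Real.cosh (2 * dualBeta β)) * 2 + 4 + 4 * c) := h
      _ = c * N / 4 := by field_simp
  -- the loops are far apart: `4 f(N) + 2 < N`
  have hcn : c * (16 * n) < c * N := by
    nlinarith [mul_nonneg hn0 hlog2.le, mul_nonneg hn0 hlogc, hnL, hn0, hc]
  have h16 : 16 * n < N := lt_of_mul_lt_mul_left hcn hc.le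
  have hfar : (4 * (s : ℝ) + 2) < N := by linarith
  refine (znWilsonPairCov_square_translate_le_of_truncated_decay hβ hc.le hdec hij x hfar).trans ?_
  -- factor by factor: everything is `≤ e^{(const) n}`
  have e2 : (2 : ℝ) ^ (s * s) = Real.exp (n * Real.log 2) := by
    rw [hn, Real.exp_nat_mul, Real.exp_log two_pos]
  have ec : Real.cosh (2 * dualBeta β) ^ (s * s) = Real.exp (n * Real.log (Real.cosh (2 * dualBeta β))) := by
    rw [hn, Real.exp_nat_mul, Real.exp_log hcosh]
  have e3 : ((2 * (s * s) : ℕ) : ℝ) ≤ Real.exp (2 * n) := by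
    have : ((2 * (s * s) : ℕ) : ℝ) = 2 * n := by rw [hn]; push_cast; ring
    rw [this]
    linarith [Real.add_one_le_exp (2 * n)]
  have e30 : (0 : ℝ) ≤ ((2 * (s * s) : ℕ) : ℝ) := by positivity
  have hK : Real.exp (-(c * ((N : ℝ) - ((s + s + 1) + (s + s + 1))))) ≤ Real.exp (c * (4 * n + 2) - c * N) := by
    refine Real.exp_le_exp.2 ?_
    nlinarith [mul_le_mul_of_nonneg_left hsn hc.le]
  calc (2 : ℝ) ^ (s * s) * (2 : ℝ) ^ (s * s) *
        (Real.cosh (2 * dualBeta β) ^ (s * s) * Real.cosh (2 * dualBeta β) ^ (s * s) *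
          ((((2 * (s * s) : ℕ) : ℝ) * ((2 * (s * s) : ℕ) : ℝ)) *
            Real.exp (-(c * (N - ((s + s + 1) + (s + s + 1)))))))
      ≤ Real.exp (n * Real.log 2) * Real.exp (n * Real.log 2) *
        (Real.exp (n * Real.log (Real.cosh (2 * dualBeta β))) *
          Real.exp (n * Real.log (Real.cosh (2 * dualBeta β))) *
          ((Real.exp (2 * n) * Real.exp (2 * n)) * Real.exp (c * (4 * n + 2) - c * N))) := by
        rw [e2, ec]
        gcongr
    _ = Real.exp (n * Real.log 2 + n * Real.log 2 + (n * Real.log (Real.cosh (2 * dualBeta β)) +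
          n * Real.log (Real.cosh (2 * dualBeta β)) + (2 * n + 2 * n + (c * (4 * n + 2) - c * N)))) := by
        simp only [← Real.exp_add]
    _ ≤ Real.exp (-(c / 2 * N)) := by
        refine Real.exp_le_exp.2 ?_
        have hcN : c * 8 ≤ c * N := mul_le_mul_of_nonneg_left hN8r hc.le
        nlinarith [hnL, hcN]

/-- **Duncan–Schweinhart 2026 Prop. 24, upper bound, growing loops, DECONFINED phase — proved**
(`ℤ₂` LGT on `ℤ³`, `β > β_c`; `i < j`, `f(N)² ∕ N → 0`): there is `c₀ > 0` such that eventually in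
`N`, for all base points `x`, `0 ≤ Cov_β(W_{γ(N)}, W_{γ(N) + N e_k}) ≤ e^{-c₀N}`,
`γ(N) = ∂(rectPlaqs x i j f(N) f(N))`. No named fact is used (duality, sharpness of the dual Ising
model, the sharp Lemma 1.2). [cite: DuncanSchweinhart2026, Prop. 24 (pp. 19–20), dual-subcritical case] -/
theorem znWilsonPairCov_growing_le_exp_of_gt_critical {β : ℝ} (h : z2GaugeCriticalBetaThree < β)
    (hij : i < j) {f : ℕ → ℕ} (hf : Tendsto (fun N : ℕ => ((f N : ℝ) ^ 2) / N) atTop (𝓝 0)) :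
    ∃ c₀ : ℝ, 0 < c₀ ∧ ∀ᶠ N : ℕ in atTop, ∀ x : Probability.LatticeModels.Site 3,
      0 ≤ znWilsonPairCov 2 β x i j (f N) (f N) (x + Pi.single (third i j) (N : ℤ)) i j (f N) (f N) ∧
        znWilsonPairCov 2 β x i j (f N) (f N) (x + Pi.single (third i j) (N : ℤ)) i j (f N) (f N) ≤
          Real.exp (-(c₀ * N)) := by
  have hβ : 0 < β := z2GaugeCriticalBetaThree_pos.trans h
  obtain ⟨c, hc, hdec⟩ := plusCorr_truncatedTwoPoint_dualBeta_expDecay_of_gt_critical h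
  exact ⟨c / 2, by positivity, znWilsonPairCov_growing_le_exp_of_truncated_decay hβ hc hdec hij hf⟩

/-- **Duncan–Schweinhart 2026 Prop. 24, upper bound, growing loops, at every `β ≠ β_c`, modulo
[DCGR20]** (`β > 0`; the confined side `β < β_c` uses the granted decay of the truncated two-point
function of the plus state above `β_c^{Ising}(ℤ³)`, the deconfined side is unconditional).
[cite: DuncanSchweinhart2026, Prop. 24 (pp. 19–20), Thm 8 (p. 4); DuminilCopinGoswamiRaoufi2020 Thm 1.1 / Thm 1.3] -/
theorem znWilsonPairCov_growing_le_exp_of_ne_critical_of_DCGR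
    (hDCGR : ∀ β' : ℝ, criticalBeta 3 < β' → ∃ c : ℝ, 0 < c ∧ ∀ a b : Probability.LatticeModels.Site 3,
      plusCorr 3 β' 0 (({a} : Finset (Probability.LatticeModels.Site 3)) ∆ {b}) -
        plusCorr 3 β' 0 {a} * plusCorr 3 β' 0 {b} ≤ Real.exp (-(c * ‖a - b‖)))
    {β : ℝ} (hβ : 0 < β) (hne : β ≠ z2GaugeCriticalBetaThree)
    (hij : i < j) {f : ℕ → ℕ} (hf : Tendsto (fun N : ℕ => ((f N : ℝ) ^ 2) / N) atTop (𝓝 0)) :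
    ∃ c₀ : ℝ, 0 < c₀ ∧ ∀ᶠ N : ℕ in atTop, ∀ x : Probability.LatticeModels.Site 3,
      0 ≤ znWilsonPairCov 2 β x i j (f N) (f N) (x + Pi.single (third i j) (N : ℤ)) i j (f N) (f N) ∧
        znWilsonPairCov 2 β x i j (f N) (f N) (x + Pi.single (third i j) (N : ℤ)) i j (f N) (f N) ≤
          Real.exp (-(c₀ * N)) := by
  obtain ⟨c, hc, hdec⟩ := plusCorr_truncatedTwoPoint_dualBeta_expDecay_of_ne_critical_of_DCGR hDCGR hβ hne
  exact ⟨c / 2, by positivity, znWilsonPairCov_growing_le_exp_of_truncated_decay hβ hc hdec hij hf⟩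

/-- **Duncan–Schweinhart 2026 Prop. 24, upper bound, growing loops, at every `β ≠ β_c`, from the
tree's named fact `DuminilCopinGoswamiRaoufi2020_truncatedTwoPointPlus_expDecay 3`** (`β > 0`,
`i < j`, `f(N)² ∕ N → 0`). [cite: DuncanSchweinhart2026, Prop. 24 (pp. 19–20), Thm 8 (p. 4); DuminilCopinGoswamiRaoufi2020 Thm 1.1] -/
theorem znWilsonPairCov_growing_le_exp_of_ne_critical_of_DCGR2020
    (h : DuminilCopinGoswamiRaoufi2020_truncatedTwoPointPlus_expDecay 3) {β : ℝ} (hβ : 0 < β)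
    (hne : β ≠ z2GaugeCriticalBetaThree) (hij : i < j) {f : ℕ → ℕ}
    (hf : Tendsto (fun N : ℕ => ((f N : ℝ) ^ 2) / N) atTop (𝓝 0)) :
    ∃ c₀ : ℝ, 0 < c₀ ∧ ∀ᶠ N : ℕ in atTop, ∀ x : Probability.LatticeModels.Site 3,
      0 ≤ znWilsonPairCov 2 β x i j (f N) (f N) (x + Pi.single (third i j) (N : ℤ)) i j (f N) (f N) ∧
        znWilsonPairCov 2 β x i j (f N) (f N) (x + Pi.single (third i j) (N : ℤ)) i j (f N) (f N) ≤
          Real.exp (-(c₀ * N)) :=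
  znWilsonPairCov_growing_le_exp_of_ne_critical_of_DCGR (dcgr2020_three_upper h) hβ hne hij hf

end Growing

end Z2Duality

end Literature.MathematicalPhysics.QuantumFieldTheory
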